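import Summits.BirchSwinnertonDyer.Rank1Residual.GaloisImage.KuriharaRecordCorollaryThreeDeep
import Summits.BirchSwinnertonDyer.Rank1Residual.Additive.X4RankZeroKuriharaWitness
import Summits.BirchSwinnertonDyer.Rank1Residual.Additive.X4ThreeResCertKernel
import HarnessLib

/-!
# `BSD(E,3)` on class A2 (DEEP side) from ONE Kurihara certificate at `n ∈ 𝒩_{2t+1}` — the
# RECORD-READY END COROLLARIES of sub-route (a′) through additive-p4's LOWER-half sockets
# (cell `b2b-bsdres`, team n1011, ROUTE-1 R1-53 E3 / R1-45 (e); row T-R1-45 FILE E4; seat p18)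

HONEST FRAMING (cell `b2b-bsdres`, run/shared/lean/b2b/bsd-rank1-residual/, verbatim in every
file): the goal of the cell is to DELETE the COMBINATION-SHAPED residual classes of the
Birch–Swinnerton-Dyer formula for ALL analytic-rank `≤ 1` elliptic curves over `ℚ` — "full BSD
formula for every rank `≤ 1` curve in class `C`" assembled STRICTLY from published theorems — so
that the rank-`≤ 1` remainder becomes exactly the CONSTRUCTION-SHAPED classes, which are TYPED
(missing-input `Prop`s), NOT attempted. This is not "finishing BSD". Team n1011 (N10/N11, the
additive block `X4 ∧ p = 3`): research route; PER-PAIR record shape, NOT a class theorem; TOOL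
theorems only (no definition, no named fact); nothing booked; no mark / label moved.  CONDITIONAL
on: the two S24-DEEP PORTS `hS24d`/`hS24d₂` (cc-typer-1 `KolyvaginDeepSubclass.lean`, flag
`S24-DEEP-PORT@3` — NOT the printed [S24] Thm. 4.4; class A1 is `KuriharaRecordBSDpThree.lean`), the
Poitou–Tate families, Tate's `hEP`, ONE typed dictionary PORT `KatoKuriharaPortThreeAt W t v₃` (FLAG
`K22-Thm3.13-PORT@3`, the DICT3 debt line; GUARD G-V1: depth `k := t`, modulus `3`, `t + 1 ≤ t + 1`), and — for the UPPER half of `BSD(E,3)` — the five named facts of the X4 chain of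
record (`hKatoS hDel hmodD hL20 hKatoχ`) with `hGZK`, `hmod`, `h26` [+ `hCT` on the defect-one rows],
exactly as `Additive/X4ThreeResCertKernel.lean` / `Additive/X4RankZeroKuriharaWitness.lean`.  The
certificate lines are per-record EVIDENCE decided in the kernel on numerals.

## What and why

`Assembly.exists_LOmega_padicValRat_le_of_towerSurj_deep` (file E3,
`KuriharaRecordCorollaryThreeDeep.lean`, deep glue by n1011-p15) is Kurihara's LOWER half
`∃ q, L(E,1)/Ω(W) = q ∧ ord₃ q ≤ ord₃ #Ш(E)(3) + (j − 1)` on class A2 from the `3`-adic tower, the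
two S24-DEEP ports, PT, `hEP`, the dictionary port and ONE certificate at `n ∈ 𝒩_{k+t+1}`; here it is
read at `j = 1`, `k := t` (so the certificate lives at `n ∈ 𝒩_{2t+1}`: the class-A2 pilot 17190k1
has `t = 1`, `n = 541·811 ∈ 𝒩₃`).  additive-p4's sockets
(`Additive/X4RankZeroKuriharaWitness.lean`, p249363) turn exactly this output shape into `BSD(E,p)`
with the UPPER half from the X4 chain of record.  Composed here, in the record shape of
`Additive/X4ThreeKuriharaCertKernel.lean` (integer model `E₀`, tower record, optimal datum):

* `Assembly.bsdp_three_of_towerSurj_of_kolyvaginProduct_deep` — potentially GOOD, `3 ∤ ∏ c_ℓ` (the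
  unit-Tamagawa LOWER@3 window rows), socket `X4RankZero.bsdp_three_of_towerSurj_of_optimal_of_LOmegaWitness`;
* `Assembly.bsdp_three_potMult_of_towerSurj_of_kolyvaginProduct_deep` — `ord₃ j < 0`, socket
  `X4RankZero.bsdp_three_potMult_of_LOmegaWitness`;
* `Assembly.bsdp_three_of_towerSurj_of_kolyvaginProduct_deep_of_even` — Tamagawa defect ONE with
  `ord₃ #Ш_an` even, socket `X4RankZero.bsdp_three_of_towerSurj_of_optimal_of_LOmegaWitness_of_even`.

What it does NOT do: discharge the three ports, the PT families, `hEP` or the UPPER-half facts;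
close any class; move any mark.

References: C.-H. Kim, AJM 148 (2026) Thm. 1.9 (6) [Kim2022StructureSelmer]; R. Sakamoto, JTNB 36
(2024) Thm. 4.4 [Sakamoto2024]; K. Kato, Astérisque 295 (2004) Thm. 14.5 (3), Prop. 14.16 (2)
[Kato2004Asterisque]; D. Delbourgo (1998) Prop. 4 [Delbourgo1998]; C. Wuthrich (2014) Lemma 20
[Wuthrich2014]; A. Agashe, K. Ribet, W. Stein (2006) Thm. 2.6 [AgasheRibetStein2006]; R. L. Miller,
LMS JCM 14 (2011) Def. 1.1 [Miller2011LMS].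
-/

noncomputable section

open scoped Classical NumberField ContRepresentation
open Function Field NumberField IsDedekindDomain IsDedekindDomain.HeightOneSpectrum WeierstrassCurve
  CongruenceSubgroup
  Literature.NumberTheory.EllipticCurves Literature.NumberTheory.EllipticCurves.ModularForms
  Literature.NumberTheory.EllipticCurves.Rank1Residual
  Literature.NumberTheory.EllipticCurves.AgasheRibetStein2006
  Literature.NumberTheory.GaloisRepresentations
  Literature.NumberTheory.GaloisRepresentations.DiscreteGaloisModule Literature.NumberTheory.GaloisCohomology
  Rat.HeightOneSpectrum
  Summit.BirchSwinnertonDyer.Rank1Residual.Additive Summit.BirchSwinnertonDyer.Rank1Residual.X4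

namespace Summit.BirchSwinnertonDyer.Rank1Residual.GaloisImage.Assembly

/-- **`BSD(E,3)` on class A2 (deep side), potentially GOOD, `3 ∤ ∏ c_ℓ`, from ONE Kurihara
certificate at `n ∈ 𝒩_{2t+1}`** — RECORD-READY.  Globally minimal elliptic `W/ℚ` with integer model `E₀`,
`3 ∣ Δ(E₀)`, `3 ∣ c₄(E₀)` (ADDITIVE at `3`), the `3`-adic tower, `#E(ℚ₃)[3] = 3^t`, `r_an = 0`,
`3 ∤ ∏ c_ℓ`, an OPTIMAL datum `D` at `N ≤ 130000`; the named facts of the X4 chain of record for the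
UPPER half (`hKatoS hDel hmodD hL20 hKatoχ`, GZK, modularity, `h26`); for the LOWER half the two
S24-DEEP PORTS, the Poitou–Tate families, Tate's `hEP`, ONE port `KatoKuriharaPortThreeAt W t v₃`
(FLAG `K22-Thm3.13-PORT@3`) and the CERTIFICATE (`n ∈ 𝒩_{2t+1}`, cyclicity at its primes, `ℓ ∤ N`,
surjective `ψ`, `δ̃_n(ψ) ≢ 0 (mod 3)`, `δ̃_d(ψ) = 0` at `1 < d < n`) ⟹ **`BSD(E,3)`**.  The output
shape of `exists_LOmega_padicValRat_le_of_towerSurj_deep` (at `k = t`, `j = 1`) fed into additive-p4's socket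
`X4RankZero.bsdp_three_of_towerSurj_of_optimal_of_LOmegaWitness`.  Per pair; NOT a class theorem;
nothing booked; no mark moved. [cite: Kim2022StructureSelmer, Thm. 1.9 (6)]
[cite: Sakamoto2024, Thm. 4.4 (p. 926)] [cite: Kato2004Asterisque, Thm. 14.5 (3) (p. 236)]
[cite: AgasheRibetStein2006, Thm. 2.6 (p. 619)] [cite: Miller2011LMS, §1 and Def. 1.1] -/
theorem bsdp_three_of_towerSurj_of_kolyvaginProduct_deep
    (hKatoS : Kato2004.rankZero_padicValNat_sha_le_sub_localTamagawa_of_additive_potGood_of_imageContainsSL2)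
    (hDel : Delbourgo1998.prop4_rankZero_pow_dvd_constantCoeff)
    (hGZK : rank_eq_analyticRank_of_analyticRank_le_one) (hmod : hasEntireLFunction_rat)
    (hmodD : nonempty_modularParametrizationData)
    (hL20 : Wuthrich2014.lemma20_surjective_threeAdic_of_semistable)
    (hKatoχ : Wuthrich2014.kato_halfEigenCharIdeal_dvd_cyclotomicPrime_of_surjective)
    (h26 : cremona_abs_maninConstant_eq_one_of_level_le)
    (hS24d : S24Deep.kolyvaginSystems_freeRankOne_zmod_three_pow_deep)
    (hS24d₂ : S24Deep.kolyvaginSystems_idealOfBasis_eq_fittingIdeal_zmod_three_pow_deep)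
    (W : WeierstrassCurve ℚ) [W.IsElliptic] [W.IsGloballyMinimal] (t : ℕ)
    {E₀ : WeierstrassCurve ℤ} (hI : integralModelInt W = E₀)
    (hΔ : (3 : ℤ) ∣ E₀.Δ) (hc₄ : (3 : ℤ) ∣ E₀.c₄)
    (htower : ∀ m : ℕ, W.HasSurjectiveModNGaloisRep (3 ^ m : ℕ))
    (ht : Nat.card {Q : (W.baseChange ℚ_[3]).toAffine.Point // (3 : ℕ) • Q = 0} = 3 ^ t)
    (hr : W.analyticRank = 0) (htam : ¬ 3 ∣ W.tamagawaProduct)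
    {N : ℕ} [NeZero N] (hN : N ≤ 130000) (D : ModularParametrizationData W N)
    (hopt : ∀ z ∈ D.L.lattice, ∃ w ∈ periodLattice D.f, z = D.c * w)
    (inv : LocalInvariants ℚ 3) (hperf : inv.IsPerfect) (hsum : inv.SumLocalTermEqZero)
    (hcompl : inv.SelmerComplement)
    (inv' : ∀ k' : ℕ, LocalInvariants ℚ (3 ^ (k' + 1))) (hperf' : ∀ k', (inv' k').IsPerfect)
    (hsum' : ∀ k', (inv' k').SumLocalTermEqZero) (hcompl' : ∀ k', (inv' k').SelmerComplement)
    (hinj' : ∀ k', ∀ v : HeightOneSpectrum (𝓞 ℚ), Injective (inv' k' (Sum.inr v)))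
    (hEP : ∀ v : HeightOneSpectrum (𝓞 ℚ), localEulerPoincareCharacteristic (v.adicCompletion ℚ))
    (v₃ : HeightOneSpectrum (𝓞 ℚ)) (hv₃ : ((3 : ℕ) : 𝓞 ℚ) ∈ v₃.asIdeal)
    (hPort : KatoKuriharaPortThreeAt W t v₃)
    (n : ℕ) [NeZero n] (hn : Kato.IsKolyvaginProduct W 3 (t + t + 1) n)
    (hcyc : ∀ (ℓ : ℕ) [Fact ℓ.Prime], ℓ ∣ n →
      Nat.card {P : ((integralModelInt W).map (Int.castRingHom (ZMod ℓ))).toAffine.Point //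
        3 • P = 0} ≤ 3)
    (hnN : ∀ ℓ ∈ n.primeFactors, ¬ ℓ ∣ N)
    (ψ : (ℓ : ℕ) → (ZMod ℓ)ˣ →* Multiplicative (ZMod (3 ^ 1)))
    (hψ : ∀ ℓ ∈ n.primeFactors, Function.Surjective (ψ ℓ))
    (hcert : kuriharaNumber D.f (3 ^ 1) n ψ ≠ 0)
    (hv : ∀ d : ℕ, d ∣ n → 1 < d → d < n → ∀ [NeZero d], kuriharaNumber D.f (3 ^ 1) d ψ = 0) :
    BSDp W 3 := by
  haveI : Fact (Nat.Prime 3) := ⟨Nat.prime_three⟩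
  have hadd : Addv W 3 := addv_of_intModel hI 3 (by exact_mod_cast hΔ) (by exact_mod_cast hc₄)
  have hc3 : ¬ 3 ∣ (W.baseChange ℚ_[3]).localTamagawaNumber ℤ_[3] := fun h =>
    htam (h.trans (localTamagawaNumber_padic_dvd_tamagawaProduct W 3))
  have hsurj : W.HasSurjectiveModNGaloisRep 3 := by simpa using htower 1
  obtain ⟨q₀, hq₀, hw⟩ := exists_LOmega_padicValRat_le_of_towerSurj_deep hS24d hS24d₂ hGZK hmod h26 W
    t t hadd hc3 htower ht hr hN D hopt inv hperf hsum hcompl inv' hperf' hsum' hcompl' hinj' hEP v₃ hv₃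
    hPort n hn hcyc hnN (j := 1) (by omega) ψ hψ hcert hv
  replace hw : padicValRat 3 q₀ ≤
      (padicValNat 3 (Nat.card (AddCommGroup.primaryComponent W.sha 3)) : ℤ) := by simpa using hw
  exact X4RankZero.bsdp_three_of_towerSurj_of_optimal_of_LOmegaWitness W hKatoS hDel hGZK hmod hmodD
    hL20 hKatoχ h26 hadd hsurj htower hr htam hN ⟨D, hopt⟩ hq₀ hw

/-- **`BSD(E,3)` on class A2 (deep side), potentially MULTIPLICATIVE (`ord₃ j < 0`), from ONE
Kurihara certificate at `n ∈ 𝒩_{2t+1}`** — the (M) branch: the output shape fed into additive-p4's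
`X4RankZero.bsdp_three_potMult_of_LOmegaWitness` (no Tamagawa / Manin binder on the upper half; the
lower half still uses the optimal datum for the period transfer and `3 ∤ c₃`).  Per pair; nothing
booked. [cite: Kim2022StructureSelmer, Thm. 1.9 (6)] [cite: Delbourgo1998, Prop. 4 (p. 144)]
[cite: Wuthrich2014, Lemma 20 (p. 399)] [cite: Miller2011LMS, §1 and Def. 1.1] -/
theorem bsdp_three_potMult_of_towerSurj_of_kolyvaginProduct_deep
    (hKatoS : Kato2004.rankZero_padicValNat_sha_le_sub_localTamagawa_of_additive_potGood_of_imageContainsSL2)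
    (hDel : Delbourgo1998.prop4_rankZero_pow_dvd_constantCoeff)
    (hGZK : rank_eq_analyticRank_of_analyticRank_le_one) (hmod : hasEntireLFunction_rat)
    (hmodD : nonempty_modularParametrizationData)
    (hL20 : Wuthrich2014.lemma20_surjective_threeAdic_of_semistable)
    (hKatoχ : Wuthrich2014.kato_halfEigenCharIdeal_dvd_cyclotomicPrime_of_surjective)
    (h26 : cremona_abs_maninConstant_eq_one_of_level_le)
    (hS24d : S24Deep.kolyvaginSystems_freeRankOne_zmod_three_pow_deep)
    (hS24d₂ : S24Deep.kolyvaginSystems_idealOfBasis_eq_fittingIdeal_zmod_three_pow_deep)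
    (W : WeierstrassCurve ℚ) [W.IsElliptic] [W.IsGloballyMinimal] (t : ℕ)
    {E₀ : WeierstrassCurve ℤ} (hI : integralModelInt W = E₀)
    (hΔ : (3 : ℤ) ∣ E₀.Δ) (hc₄ : (3 : ℤ) ∣ E₀.c₄)
    (htower : ∀ m : ℕ, W.HasSurjectiveModNGaloisRep (3 ^ m : ℕ))
    (ht : Nat.card {Q : (W.baseChange ℚ_[3]).toAffine.Point // (3 : ℕ) • Q = 0} = 3 ^ t)
    (hr : W.analyticRank = 0) (hjneg : padicValRat 3 W.j < 0)
    (hc3 : ¬ 3 ∣ (W.baseChange ℚ_[3]).localTamagawaNumber ℤ_[3])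
    {N : ℕ} [NeZero N] (hN : N ≤ 130000) (D : ModularParametrizationData W N)
    (hopt : ∀ z ∈ D.L.lattice, ∃ w ∈ periodLattice D.f, z = D.c * w)
    (inv : LocalInvariants ℚ 3) (hperf : inv.IsPerfect) (hsum : inv.SumLocalTermEqZero)
    (hcompl : inv.SelmerComplement)
    (inv' : ∀ k' : ℕ, LocalInvariants ℚ (3 ^ (k' + 1))) (hperf' : ∀ k', (inv' k').IsPerfect)
    (hsum' : ∀ k', (inv' k').SumLocalTermEqZero) (hcompl' : ∀ k', (inv' k').SelmerComplement)
    (hinj' : ∀ k', ∀ v : HeightOneSpectrum (𝓞 ℚ), Injective (inv' k' (Sum.inr v)))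
    (hEP : ∀ v : HeightOneSpectrum (𝓞 ℚ), localEulerPoincareCharacteristic (v.adicCompletion ℚ))
    (v₃ : HeightOneSpectrum (𝓞 ℚ)) (hv₃ : ((3 : ℕ) : 𝓞 ℚ) ∈ v₃.asIdeal)
    (hPort : KatoKuriharaPortThreeAt W t v₃)
    (n : ℕ) [NeZero n] (hn : Kato.IsKolyvaginProduct W 3 (t + t + 1) n)
    (hcyc : ∀ (ℓ : ℕ) [Fact ℓ.Prime], ℓ ∣ n →
      Nat.card {P : ((integralModelInt W).map (Int.castRingHom (ZMod ℓ))).toAffine.Point //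
        3 • P = 0} ≤ 3)
    (hnN : ∀ ℓ ∈ n.primeFactors, ¬ ℓ ∣ N)
    (ψ : (ℓ : ℕ) → (ZMod ℓ)ˣ →* Multiplicative (ZMod (3 ^ 1)))
    (hψ : ∀ ℓ ∈ n.primeFactors, Function.Surjective (ψ ℓ))
    (hcert : kuriharaNumber D.f (3 ^ 1) n ψ ≠ 0)
    (hv : ∀ d : ℕ, d ∣ n → 1 < d → d < n → ∀ [NeZero d], kuriharaNumber D.f (3 ^ 1) d ψ = 0) :
    BSDp W 3 := by
  haveI : Fact (Nat.Prime 3) := ⟨Nat.prime_three⟩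
  have hadd : Addv W 3 := addv_of_intModel hI 3 (by exact_mod_cast hΔ) (by exact_mod_cast hc₄)
  have hsurj : W.HasSurjectiveModNGaloisRep 3 := by simpa using htower 1
  have hX : ClassX4 W 3 :=
    ⟨by norm_num, hadd, hasIrreducibleModPGaloisRep_of_hasSurjectiveModNGaloisRep W 3 hsurj⟩
  obtain ⟨q₀, hq₀, hw⟩ := exists_LOmega_padicValRat_le_of_towerSurj_deep hS24d hS24d₂ hGZK hmod h26 W
    t t hadd hc3 htower ht hr hN D hopt inv hperf hsum hcompl inv' hperf' hsum' hcompl' hinj' hEP v₃ hv₃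
    hPort n hn hcyc hnN (j := 1) (by omega) ψ hψ hcert hv
  replace hw : padicValRat 3 q₀ ≤
      (padicValNat 3 (Nat.card (AddCommGroup.primaryComponent W.sha 3)) : ℤ) := by simpa using hw
  exact X4RankZero.bsdp_three_potMult_of_LOmegaWitness W hKatoS hDel hGZK hmod hmodD hL20 hKatoχ hr hX
    hsurj hjneg hq₀ (j := 0) (Nat.zero_le _) (by simpa using hw)

/-- **`BSD(E,3)` on class A2 (deep side), potentially GOOD, Tamagawa defect ONE (`ord₃ ∏ c_ℓ ≤ ord₃ c₃ + 1`,
`ord₃ #Ш_an` even), from ONE Kurihara certificate** — the parity socket: the output shape fed into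
additive-p4's `X4RankZero.bsdp_three_of_towerSurj_of_optimal_of_LOmegaWitness_of_even` (sharp Kato
+ Cassels–Tate + `ord₃ #Ш_an` even).  Per pair; nothing booked.
[cite: Kim2022StructureSelmer, Thm. 1.9 (6)] [cite: Kato2004Asterisque, Thm. 14.5 (3) (p. 236), Prop. 14.16 (2) (p. 244)]
[cite: AgasheRibetStein2006, Thm. 2.6 (p. 619)] [cite: Miller2011LMS, §1 and Def. 1.1] -/
theorem bsdp_three_of_towerSurj_of_kolyvaginProduct_deep_of_even
    (hCT : exists_casselsTate_pairing (K := ℚ))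
    (hKatoS : Kato2004.rankZero_padicValNat_sha_le_sub_localTamagawa_of_additive_potGood_of_imageContainsSL2)
    (hGZK : rank_eq_analyticRank_of_analyticRank_le_one) (hmod : hasEntireLFunction_rat)
    (h26 : cremona_abs_maninConstant_eq_one_of_level_le)
    (hS24d : S24Deep.kolyvaginSystems_freeRankOne_zmod_three_pow_deep)
    (hS24d₂ : S24Deep.kolyvaginSystems_idealOfBasis_eq_fittingIdeal_zmod_three_pow_deep)
    (W : WeierstrassCurve ℚ) [W.IsElliptic] [W.IsGloballyMinimal] (t : ℕ)
    {E₀ : WeierstrassCurve ℤ} (hI : integralModelInt W = E₀)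
    (hΔ : (3 : ℤ) ∣ E₀.Δ) (hc₄ : (3 : ℤ) ∣ E₀.c₄)
    (htower : ∀ m : ℕ, W.HasSurjectiveModNGaloisRep (3 ^ m : ℕ))
    (ht : Nat.card {Q : (W.baseChange ℚ_[3]).toAffine.Point // (3 : ℕ) • Q = 0} = 3 ^ t)
    (hr : W.analyticRank = 0) (hpot : 0 ≤ padicValRat 3 W.j)
    (hc3 : ¬ 3 ∣ (W.baseChange ℚ_[3]).localTamagawaNumber ℤ_[3])
    (hdef : haveI : Fact (Nat.Prime 3) := ⟨Nat.prime_three⟩;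
      padicValNat 3 W.tamagawaProduct ≤
        padicValNat 3 ((W.baseChange ℚ_[3]).localTamagawaNumber ℤ_[3]) + 1)
    {q : ℚ} (hq : shaAn W = (q : ℂ)) (heven : Even (padicValRat 3 q))
    {N : ℕ} [NeZero N] (hN : N ≤ 130000) (D : ModularParametrizationData W N)
    (hopt : ∀ z ∈ D.L.lattice, ∃ w ∈ periodLattice D.f, z = D.c * w)
    (inv : LocalInvariants ℚ 3) (hperf : inv.IsPerfect) (hsum : inv.SumLocalTermEqZero)
    (hcompl : inv.SelmerComplement)
    (inv' : ∀ k' : ℕ, LocalInvariants ℚ (3 ^ (k' + 1))) (hperf' : ∀ k', (inv' k').IsPerfect)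
    (hsum' : ∀ k', (inv' k').SumLocalTermEqZero) (hcompl' : ∀ k', (inv' k').SelmerComplement)
    (hinj' : ∀ k', ∀ v : HeightOneSpectrum (𝓞 ℚ), Injective (inv' k' (Sum.inr v)))
    (hEP : ∀ v : HeightOneSpectrum (𝓞 ℚ), localEulerPoincareCharacteristic (v.adicCompletion ℚ))
    (v₃ : HeightOneSpectrum (𝓞 ℚ)) (hv₃ : ((3 : ℕ) : 𝓞 ℚ) ∈ v₃.asIdeal)
    (hPort : KatoKuriharaPortThreeAt W t v₃)
    (n : ℕ) [NeZero n] (hn : Kato.IsKolyvaginProduct W 3 (t + t + 1) n)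
    (hcyc : ∀ (ℓ : ℕ) [Fact ℓ.Prime], ℓ ∣ n →
      Nat.card {P : ((integralModelInt W).map (Int.castRingHom (ZMod ℓ))).toAffine.Point //
        3 • P = 0} ≤ 3)
    (hnN : ∀ ℓ ∈ n.primeFactors, ¬ ℓ ∣ N)
    (ψ : (ℓ : ℕ) → (ZMod ℓ)ˣ →* Multiplicative (ZMod (3 ^ 1)))
    (hψ : ∀ ℓ ∈ n.primeFactors, Function.Surjective (ψ ℓ))
    (hcert : kuriharaNumber D.f (3 ^ 1) n ψ ≠ 0)
    (hv : ∀ d : ℕ, d ∣ n → 1 < d → d < n → ∀ [NeZero d], kuriharaNumber D.f (3 ^ 1) d ψ = 0) :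
    BSDp W 3 := by
  haveI : Fact (Nat.Prime 3) := ⟨Nat.prime_three⟩
  have hadd : Addv W 3 := addv_of_intModel hI 3 (by exact_mod_cast hΔ) (by exact_mod_cast hc₄)
  have hsurj : W.HasSurjectiveModNGaloisRep 3 := by simpa using htower 1
  obtain ⟨q₀, hq₀, hw⟩ := exists_LOmega_padicValRat_le_of_towerSurj_deep hS24d hS24d₂ hGZK hmod h26 W
    t t hadd hc3 htower ht hr hN D hopt inv hperf hsum hcompl inv' hperf' hsum' hcompl' hinj' hEP v₃ hv₃
    hPort n hn hcyc hnN (j := 1) (by omega) ψ hψ hcert hv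
  replace hw : padicValRat 3 q₀ ≤
      (padicValNat 3 (Nat.card (AddCommGroup.primaryComponent W.sha 3)) : ℤ) := by simpa using hw
  exact X4RankZero.bsdp_three_of_towerSurj_of_optimal_of_LOmegaWitness_of_even W hCT hKatoS hGZK hmod
    h26 hadd hsurj htower hr hpot hN ⟨D, hopt⟩ hdef hq heven hq₀ (j := 0) (Nat.zero_le _)
    (by simpa using hw)

end Summit.BirchSwinnertonDyer.Rank1Residual.GaloisImage.Assembly

end
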